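import Summits.FinalStateConjecture.FinalStateConjecture.Theorems.EIHFluxBalanceInertialRecessionStubEndgameBasics

/-!
# Route EIHFluxBalance — crux `InertialRecession`, abstract endgame for general `N`:
# the fly-by budget integral (toward LEMMA SPLIT, visits, block L2)

Helper file for the crux `stmt-FinalStateConjecture-10166` (virial route, `work/split/PLAN.md`, N = 3 doubly-bad case).
Mathlib-only, calculus. Along a quasi-straight relative motion at speed `c` with pericentre distance `≥ r`, the window radius is
`≳ max(r, c|s − m|)`, and the flux budget `∫ (max(r, c|s − m|))^{-3/2} ds` over ANY time interval is at most `6 r^{-1/2}/c`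
(`integral_inv_rpow_max_le`): the core `|s − m| ≤ r/c` costs `(2r/c)·r^{-3/2}`, each tail `2r^{-1/2}/c`
(`Endgame.integral_inv_rpow_three_halves_mul_le`).
-/

noncomputable section

open Set Filter Topology MeasureTheory intervalIntegral

namespace Summit.FinalStateConjecture.FinalStateConjecture.Theorems.SublinearIsFree.Virial

open Literature.Geometry.Lorentzian
open Summit.FinalStateConjecture.FinalStateConjecture.Theorems.SublinearIsFree.Endgame

/-- One tail of the fly-by budget: `∫_{q}^{t₂} (c(s − m))^{-3/2} ds ≤ 2r^{-1/2}/c` when `q − m ≥ r/c > 0`. [folklore] -/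
theorem integral_tail_le {r c m q t₂ : ℝ} (hr : 0 < r) (hc : 0 < c) (hq : r / c ≤ q - m) (hqt : q ≤ t₂) :
    ∫ s in q..t₂, ((c * (s - m)) ^ (3 / 2 : ℝ))⁻¹ ≤ 2 * (r ^ (1 / 2 : ℝ))⁻¹ / c := by
  have hrc : 0 < r / c := by positivity
  have hqm : 0 < q - m := hrc.trans_le hq
  have hsub := intervalIntegral.integral_comp_sub_right (fun u ↦ ((c * u) ^ (3 / 2 : ℝ))⁻¹) m (a := q) (b := t₂)
  rw [hsub]
  have h1 := integral_inv_rpow_three_halves_mul_le hc hqm (by linarith : q - m ≤ t₂ - m)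
  have h2 : ((q - m) ^ (1 / 2 : ℝ))⁻¹ ≤ ((r / c) ^ (1 / 2 : ℝ))⁻¹ :=
    inv_anti₀ (Real.rpow_pos_of_pos hrc _) (Real.rpow_le_rpow hrc.le hq (by norm_num))
  have h3 : 2 * (c ^ (3 / 2 : ℝ))⁻¹ * ((r / c) ^ (1 / 2 : ℝ))⁻¹ = 2 * (r ^ (1 / 2 : ℝ))⁻¹ / c := by
    have hc32 : c ^ (3 / 2 : ℝ) = c * c ^ (1 / 2 : ℝ) := by
      rw [show (3 / 2 : ℝ) = 1 + 1 / 2 by norm_num, Real.rpow_add hc, Real.rpow_one]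
    have hc12 : 0 < c ^ (1 / 2 : ℝ) := Real.rpow_pos_of_pos hc _
    have hr12 : 0 < r ^ (1 / 2 : ℝ) := Real.rpow_pos_of_pos hr _
    rw [Real.div_rpow hr.le hc.le, hc32]
    field_simp
  calc ∫ x in q - m..t₂ - m, ((c * x) ^ (3 / 2 : ℝ))⁻¹ ≤ 2 * (c ^ (3 / 2 : ℝ))⁻¹ * ((q - m) ^ (1 / 2 : ℝ))⁻¹ := h1
    _ ≤ 2 * (c ^ (3 / 2 : ℝ))⁻¹ * ((r / c) ^ (1 / 2 : ℝ))⁻¹ :=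
        mul_le_mul_of_nonneg_left h2 (by positivity)
    _ = 2 * (r ^ (1 / 2 : ℝ))⁻¹ / c := h3

/-- **The fly-by budget integral** (see the module docstring). [folklore] -/
theorem integral_inv_rpow_max_le {r c m t₁ t₂ : ℝ} (hr : 0 < r) (hc : 0 < c) (h12 : t₁ ≤ t₂) :
    ∫ s in t₁..t₂, ((max r (c * |s - m|)) ^ (3 / 2 : ℝ))⁻¹ ≤ 6 * (r ^ (1 / 2 : ℝ))⁻¹ / c := by
  -- the integrand
  obtain ⟨f, hf⟩ : ∃ f : ℝ → ℝ, f = fun s ↦ ((max r (c * |s - m|)) ^ (3 / 2 : ℝ))⁻¹ := ⟨_, rfl⟩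
  have hfap : ∀ s, f s = ((max r (c * |s - m|)) ^ (3 / 2 : ℝ))⁻¹ := fun s ↦ by rw [hf]
  have hpos : ∀ s, 0 < max r (c * |s - m|) := fun s ↦ hr.trans_le (le_max_left _ _)
  have hfc : Continuous f := by
    rw [hf]
    have h1 : Continuous fun s ↦ max r (c * |s - m|) := by fun_prop
    exact (h1.rpow_const fun s ↦ Or.inl (hpos s).ne').inv₀ fun s ↦ (Real.rpow_pos_of_pos (hpos s) _).ne'
  have hfi : ∀ a b, IntervalIntegrable f volume a b := fun a b ↦ hfc.intervalIntegrable a b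
  have hfr : ∀ s, f s ≤ (r ^ (3 / 2 : ℝ))⁻¹ := fun s ↦ by
    rw [hfap]
    exact inv_anti₀ (Real.rpow_pos_of_pos hr _) (Real.rpow_le_rpow hr.le (le_max_left _ _) (by norm_num))
  have hrc : 0 < r / c := by positivity
  have hfR : ∀ s, m + r / c ≤ s → f s ≤ ((c * (s - m)) ^ (3 / 2 : ℝ))⁻¹ := fun s hs ↦ by
    rw [hfap]
    have h0 : 0 ≤ s - m := by linarith
    have h1 : c * (s - m) ≤ max r (c * |s - m|) := by rw [abs_of_nonneg h0]; exact le_max_right _ _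
    have h2 : 0 < c * (s - m) := by
      have : r ≤ c * (s - m) := (div_le_iff₀' hc).mp (by linarith)
      exact hr.trans_le this
    exact inv_anti₀ (Real.rpow_pos_of_pos h2 _) (Real.rpow_le_rpow h2.le h1 (by norm_num))
  have hfL : ∀ s, s ≤ m - r / c → f s ≤ ((c * (m - s)) ^ (3 / 2 : ℝ))⁻¹ := fun s hs ↦ by
    rw [hfap]
    have h0 : 0 ≤ m - s := by linarith
    have h1 : c * (m - s) ≤ max r (c * |s - m|) := by
      rw [abs_sub_comm, abs_of_nonneg h0]; exact le_max_right _ _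
    have h2 : 0 < c * (m - s) := by
      have : r ≤ c * (m - s) := (div_le_iff₀' hc).mp (by linarith)
      exact hr.trans_le this
    exact inv_anti₀ (Real.rpow_pos_of_pos h2 _) (Real.rpow_le_rpow h2.le h1 (by norm_num))
  -- the split points `t₁ ≤ p ≤ q ≤ t₂`
  obtain ⟨p, hpdef⟩ : ∃ p : ℝ, p = max t₁ (min (m - r / c) t₂) := ⟨_, rfl⟩
  obtain ⟨q, hqdef⟩ : ∃ q : ℝ, q = max t₁ (min (m + r / c) t₂) := ⟨_, rfl⟩
  have ht₁p : t₁ ≤ p := hpdef ▸ le_max_left _ _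
  have hpq : p ≤ q := by
    rw [hpdef, hqdef]
    exact max_le_max le_rfl (min_le_min (by linarith) le_rfl)
  have hqt₂ : q ≤ t₂ := by rw [hqdef]; exact max_le h12 (min_le_right _ _)
  have hqp : q - p ≤ 2 * (r / c) := by
    rw [hpdef, hqdef]
    have h1 : min (m + r / c) t₂ ≤ min (m - r / c) t₂ + 2 * (r / c) := by
      rcases le_total (m - r / c) t₂ with h | h
      · rw [min_eq_left h]; linarith [min_le_left (m + r / c) t₂]
      · rw [min_eq_right h]; linarith [min_le_right (m + r / c) t₂]
    rcases le_total t₁ (min (m - r / c) t₂) with h | h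
    · rw [max_eq_right h]
      have : max t₁ (min (m + r / c) t₂) ≤ min (m - r / c) t₂ + 2 * (r / c) := max_le (by linarith) h1
      linarith
    · rw [max_eq_left h]
      have : max t₁ (min (m + r / c) t₂) ≤ t₁ + 2 * (r / c) := max_le (by linarith) (by linarith)
      linarith
  -- split the integral
  have hsplit : ∫ s in t₁..t₂, f s = (∫ s in t₁..p, f s) + (∫ s in p..q, f s) + ∫ s in q..t₂, f s := by
    rw [intervalIntegral.integral_add_adjacent_intervals (hfi t₁ p) (hfi p q),
      intervalIntegral.integral_add_adjacent_intervals (hfi t₁ q) (hfi q t₂)]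
  -- the middle
  have hmid : ∫ s in p..q, f s ≤ 2 * (r ^ (1 / 2 : ℝ))⁻¹ / c := by
    have h1 : ∫ s in p..q, f s ≤ ∫ _ in p..q, (r ^ (3 / 2 : ℝ))⁻¹ :=
      intervalIntegral.integral_mono_on hpq (hfi p q) intervalIntegrable_const fun s _ ↦ hfr s
    rw [intervalIntegral.integral_const, smul_eq_mul] at h1
    have hr32 : r ^ (3 / 2 : ℝ) = r * r ^ (1 / 2 : ℝ) := by
      rw [show (3 / 2 : ℝ) = 1 + 1 / 2 by norm_num, Real.rpow_add hr, Real.rpow_one]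
    have hr12 : 0 < r ^ (1 / 2 : ℝ) := Real.rpow_pos_of_pos hr _
    have h2 : (q - p) * (r ^ (3 / 2 : ℝ))⁻¹ ≤ 2 * (r / c) * (r ^ (3 / 2 : ℝ))⁻¹ :=
      mul_le_mul_of_nonneg_right hqp (by positivity)
    have h3 : 2 * (r / c) * (r ^ (3 / 2 : ℝ))⁻¹ = 2 * (r ^ (1 / 2 : ℝ))⁻¹ / c := by
      rw [hr32]; field_simp
    linarith
  -- the right tail
  have hright : ∫ s in q..t₂, f s ≤ 2 * (r ^ (1 / 2 : ℝ))⁻¹ / c := by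
    rcases le_or_gt t₂ (m + r / c) with h | h
    · have hq : q = t₂ := by
        rw [hqdef, min_eq_right h, max_eq_right h12]
      rw [hq, intervalIntegral.integral_same]
      positivity
    · have hq : q = max t₁ (m + r / c) := by rw [hqdef, min_eq_left h.le]
      have hqm : m + r / c ≤ q := hq ▸ le_max_right _ _
      have h1 : ∫ s in q..t₂, f s ≤ ∫ s in q..t₂, ((c * (s - m)) ^ (3 / 2 : ℝ))⁻¹ := by
        refine intervalIntegral.integral_mono_on hqt₂ (hfi q t₂) ?_ fun s hs ↦ hfR s (hqm.trans hs.1)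
        refine (ContinuousOn.inv₀ ?_ fun s hs ↦ (Real.rpow_pos_of_pos ?_ _).ne').intervalIntegrable_of_Icc hqt₂
        · exact ((continuousOn_const.mul (continuousOn_id.sub continuousOn_const)).rpow_const fun s hs ↦
            Or.inl (show c * (s - m) ≠ 0 from (mul_pos hc (by linarith [hs.1, hqm, hrc])).ne'))
        · nlinarith [hs.1, hqm, hc, hrc]
      exact h1.trans (integral_tail_le hr hc (by linarith) hqt₂)
  -- the left tail
  have hleft : ∫ s in t₁..p, f s ≤ 2 * (r ^ (1 / 2 : ℝ))⁻¹ / c := by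
    rcases le_or_gt (m - r / c) t₁ with h | h
    · have hp : p = t₁ := by
        rw [hpdef]
        exact max_eq_left ((min_le_left _ _).trans h)
      rw [hp, intervalIntegral.integral_same]
      positivity
    · have hpm : p ≤ m - r / c := by
        rw [hpdef]; exact max_le h.le (min_le_left _ _)
      have h1 : ∫ s in t₁..p, f s ≤ ∫ s in t₁..p, ((c * (m - s)) ^ (3 / 2 : ℝ))⁻¹ := by
        refine intervalIntegral.integral_mono_on ht₁p (hfi t₁ p) ?_ fun s hs ↦ hfL s (hs.2.trans hpm)
        refine (ContinuousOn.inv₀ ?_ fun s hs ↦ (Real.rpow_pos_of_pos ?_ _).ne').intervalIntegrable_of_Icc ht₁p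
        · exact ((continuousOn_const.mul (continuousOn_const.sub continuousOn_id)).rpow_const fun s hs ↦
            Or.inl (show c * (m - s) ≠ 0 from (mul_pos hc (by linarith [hs.2, hpm, hrc])).ne'))
        · nlinarith [hs.2, hpm, hc, hrc]
      -- substitute `u = m - s`
      have hsub := intervalIntegral.integral_comp_sub_left (fun u ↦ ((c * u) ^ (3 / 2 : ℝ))⁻¹) m (a := t₁) (b := p)
      rw [hsub] at h1
      -- `∫_{m - p}^{m - t₁}` with `m - p ≥ r / c`
      have h2 := integral_tail_le (m := 0) (q := m - p) (t₂ := m - t₁) hr hc (by linarith) (by linarith)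
      simp only [sub_zero] at h2
      exact h1.trans h2
  -- assemble (one atom `Y = r^{-1/2}/c` for `linarith`)
  obtain ⟨Y, hY⟩ : ∃ Y : ℝ, Y = (r ^ (1 / 2 : ℝ))⁻¹ / c := ⟨_, rfl⟩
  have e2 : 2 * (r ^ (1 / 2 : ℝ))⁻¹ / c = 2 * Y := by rw [hY]; ring
  have e6 : 6 * (r ^ (1 / 2 : ℝ))⁻¹ / c = 6 * Y := by rw [hY]; ring
  rw [e2] at hmid hright hleft
  have hall : ∫ s in t₁..t₂, f s ≤ 6 * Y := by rw [hsplit]; linarith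
  rw [e6, hf] at *
  exact hall

/-- Registered one-line form of `integral_tail_le`. [folklore] -/
theorem integral_tail_le' : open MeasureTheory intervalIntegral in ∀ {r c m q t₂ : ℝ}, 0 < r → 0 < c → r / c ≤ q - m → q ≤ t₂ → ∫ s in q..t₂, ((c * (s - m)) ^ (3 / 2 : ℝ))⁻¹ ≤ 2 * (r ^ (1 / 2 : ℝ))⁻¹ / c :=
  fun hr hc hq hqt ↦ integral_tail_le hr hc hq hqt

end Summit.FinalStateConjecture.FinalStateConjecture.Theorems.SublinearIsFree.Virial

end
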